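import Summits.BirchSwinnertonDyer.BirchSwinnertonDyer.Theorems.SignedLowerHalvesSmallImageLowerHalfBothSignsRttD2SeqJ3HS2
import Summits.BirchSwinnertonDyer.BirchSwinnertonDyer.Theorems.SignedLowerHalvesSmallImageLowerHalfBothSignsRttD2SeqJ3HLam
import HarnessLib

/-!
# Route `SignedLowerHalves`, crux L `SmallImageLowerHalfBothSigns` (stmt-BirchSwinnertonDyer-23599), line `rtt_w3` v22 — E2, row J3 = S2: ★★★ S2 FOR `M = Cofree θ F`
# WITH EVERY NON-FRAME INPUT DISCHARGED — `∃ λ` (perfect), `∀ jv` pinned, `Function.Exact (jv ∘ₗ B′.subtype) gX`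

WIDTH seat `bsd-line-slh-p3-w3` g24 under LEAD `cruxlead-stmt-BirchSwinnertonDyer-23599` g12 (cell `bsd-ssimc`); helper `--supports stmt-BirchSwinnertonDyer-23599`.
ONE THEOREM (no definition, no named fact, no instance, no `sorry`): H7f (`exact_junctionMap_comp_subtype_cofree_lam_of_lamPerfect`) + H7g (`exists_lam_perfect`). HONEST FRAMING:
the row J3 of the depleted junction (Kobayashi Thm. 7.3 i) Poitou–Tate for the partner module over the local `ℤ_p`-tower) is now a THEOREM for the LEAD's module modulo FRAME
facts only (`[IsTotallyComplex K]`, `hinst`, `hpv`/`hvp`, `hv`, `hvP`, `hvS₀`, `hPS₀`, finiteness of `P`/`S₀`, `hNP`, `hMP`, `htor`, `hγB`, `hstabK`/`hstab`, `hθ`, `hθN`), all of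
which the line's `_of` already derives from the prefix and the frame (`CharRoadFrameProps` + `CharRoadFrameSupp`). E2, crux L, crux M, BSD remain OPEN and are proved for NO curve.

★★★ `exists_lam_forall_exact_junctionMap_comp_subtype_cofree`. References: [Kobayashi2003] Thm. 7.3 i); [Rubin2000] Thm. 1.7.3, §4.2; [NeukirchSchmidtWingberg2008] VIII §6, (7.2.6);
[Kato2004Asterisque] §17.13; [SerreLocalFields1979] Ch. III §3.
-/

set_option autoImplicit false
set_option linter.dupNamespace false -- D-0017: single-problem summit, the namespace repeats the problem name by design
noncomputable section

open scoped Classical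
open NumberField IsDedekindDomain Field Matrix CategoryTheory Function

namespace Summit.BirchSwinnertonDyer.BirchSwinnertonDyer.Theorems.SmallImageRttD2Seq

open Literature.NumberTheory.EllipticCurves Literature.NumberTheory.EllipticCurves.GreenbergSelmer Literature.NumberTheory.GaloisRepresentations
  Literature.NumberTheory.GaloisRepresentations.DiscreteGaloisModule Literature.NumberTheory.GaloisCohomology
  Literature.NumberTheory.EllipticCurves.GreenbergVatsal2000 Literature.NumberTheory.ComplexMultiplication.EllipticUnits.JohnsonLeungKings2011
  Summit.BirchSwinnertonDyer.BirchSwinnertonDyer.Theorems.SmallImageCharSignedSelmer Summit.BirchSwinnertonDyer.BirchSwinnertonDyer.Theorems.SmallImageRttD2J1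

section Cofree

variable {K : Type} [Field K] [NumberField K] {p : ℕ} [Fact p.Prime] {κ : ZpExtension K p} {γ : absoluteGaloisGroup K}
  (S : Set (PadicAlgCl p)) [FiniteDimensional ℚ_[p] (padicCoeffField S)] (θ : FramedGaloisRep K (padicCoeffIntegers S) 1)
  {V : WeierstrassCurve K} {j : V.geomPrimaryTorsion p →+ Cofree θ (padicCoeffField S)} {S₀ : Set (HeightOneSpectrum (𝓞 K))} {ε : ℤˣ}
  (D : SignedTransportDualDataSat κ γ (Cofree θ (padicCoeffField S)) (padicCoeffIntegers S) V j S₀ ε)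
  {v : HeightOneSpectrum (𝓞 K)} [inst : DistribMulAction (absoluteGaloisGroup (v.adicCompletion K)) (Cofree θ (padicCoeffField S))]
  [SMulCommClass (absoluteGaloisGroup (v.adicCompletion K)) (padicCoeffIntegers S) (Cofree θ (padicCoeffField S))]
  {γv : absoluteGaloisGroup (v.adicCompletion K)} (DQ : LocalCondDualData κ (Cofree θ (padicCoeffField S)) (padicCoeffIntegers S) V j ε v γv)
  (hres : ∀ (σ : absoluteGaloisGroup (v.adicCompletion K)) (m : Cofree θ (padicCoeffField S)), σ • m = resGalOfEmb (closureEmb (K := K) (v.adicCompletion K)) σ • m)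
  (hvp : (p : 𝓞 K) ∈ v.asIdeal)
  {γB : absoluteGaloisGroup K} {θ' : absoluteGaloisGroup K →ₜ* (padicCoeffIntegers S)ˣ} {P : Set (HeightOneSpectrum (𝓞 K))}
  (I : CycIwasawaCohomologyDataO S κ γB θ' P 1)
  (hstab : ∀ m : Cofree θ (padicCoeffField S),
    IsOpen (MulAction.stabilizer (absoluteGaloisGroup (v.adicCompletion K)) m : Set (absoluteGaloisGroup (v.adicCompletion K))))
  (hθ : ∀ σ : absoluteGaloisGroup K,
    ((θ' σ : (padicCoeffIntegers S)ˣ) : padicCoeffIntegers S) * ((θ σ : GL (Fin 1) (padicCoeffIntegers S)) : Matrix (Fin 1) (Fin 1) (padicCoeffIntegers S)) 0 0 = 1)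
  (htor : ∀ m : Cofree θ (padicCoeffField S), ∃ k : ℕ, p ^ k • m = 0)
  (hγB : γB * resGalOfEmb (closureEmb (K := K) (v.adicCompletion K)) γv ∈ κ.kerSubgroup)
  (hNP : ∀ n, ramificationSubgroup K P ≤ κ.layerSubgroup n) (hv : AcSigned.IsNonsplitIn κ v)

include hv in
/-- ★★★ **S2 FOR `M = Cofree θ F` WITH NO HYPOTHESIS BEYOND THE FRAME.** There is a `ℤ_p`-linear form `λ : 𝒪 → ℤ_p` (H7g `exists_lam_perfect`) such that for
the `λ`-pairings `cofreeLamCoeffPairing S lam hlam …` EVERY pinned junction map `jv : B = I.H →ₗ[Λ_𝒪] DQ.X` (`DQ.toDual (jv b) = (𝓛.towerPairing I).pairing hstab b`; it exists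
uniquely, `existsUnique_junctionMap`) satisfies `Function.Exact (jv ∘ₗ B′.subtype) gX` on `B′ = strictCarrier I (strictLevel S κ θ′ P S₀)`. Inputs: the frame only —
`[IsTotallyComplex K]`, `hinst`, `hpv`/`hvp`, `hv`, `hvP`, `hvS₀`, `hPS₀`, `hP`/`hS₀` finite, `hNP`, `hMP`, `htor`, `hγB`, `hstabK`/`hstab`, `hθ`, `hθN : θ′|_{N_P} = 1`.
(H7f + H7g.) [cite: Kobayashi2003, Thm. 7.3 i)] [cite: Rubin2000, Thm. 1.7.3, §4.2] [cite: NeukirchSchmidtWingberg2008, VIII §6, (7.2.6)] [cite: Kato2004Asterisque, §17.13]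
[cite: SerreLocalFields1979, Ch. III §3] -/
theorem exists_lam_forall_exact_junctionMap_comp_subtype_cofree [IsTotallyComplex K]
    (hinst : inst = localAction (closureEmb (K := K) (v.adicCompletion K)) (Cofree θ (padicCoeffField S)))
    (instX : Module (IwasawaAlgebraO S) D.X) (instQ : Module (IwasawaAlgebraO S) DQ.X)
    (hιX : ∀ (f : IwasawaAlgebra p) (x : D.X), (letI := instX; iwasawaToIwasawaO S f • x) = f • x)
    (hιQ : ∀ (f : IwasawaAlgebra p) (x : DQ.X), (letI := instQ; iwasawaToIwasawaO S f • x) = f • x)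
    (hCX : ∀ (a : padicCoeffIntegers S) (x : D.X) (s : signedTransportSelmerInftySat κ (Cofree θ (padicCoeffField S)) (padicCoeffIntegers S) V j S₀ ε),
      D.toDual (letI := instX; (PowerSeries.C a : IwasawaAlgebraO S) • x) s =
        D.toDual x ⟨GreenbergSelmer.scalarH1 κ.kerSubgroup (Cofree θ (padicCoeffField S)) a s,
          scalarH1_mem_signedTransportSelmerInftySat κ (Cofree θ (padicCoeffField S)) (padicCoeffIntegers S) V j S₀ ε a s.2⟩)
    (hCQ : ∀ (a : padicCoeffIntegers S) (x : DQ.X) (c : localCondInftySat κ (Cofree θ (padicCoeffField S)) (padicCoeffIntegers S) V j ε v),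
      DQ.toDual (letI := instQ; (PowerSeries.C a : IwasawaAlgebraO S) • x) c = DQ.toDual x (scalarLocalSat κ (Cofree θ (padicCoeffField S)) (padicCoeffIntegers S) V j ε v a c))
    (hstabK : ∀ m : Cofree θ (padicCoeffField S), IsOpen (MulAction.stabilizer (absoluteGaloisGroup K) m : Set (absoluteGaloisGroup K)))
    (hγ : κ.IsTopGenerator γ) (hγv : κ.IsTopGenerator (resGalOfEmb (closureEmb (K := K) (v.adicCompletion K)) γv)) (hP : P.Finite)
    (hS₀ : S₀.Finite) (hPS₀ : ∀ w ∈ P, w ∉ S₀ → w = v) (hpv : ∀ w : HeightOneSpectrum (𝓞 K), ((p : ℕ) : 𝓞 K) ∈ w.asIdeal → w = v)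
    (hMP : ∀ w : HeightOneSpectrum (𝓞 K), w ∉ P → ∀ 𝔓 ∈ w.primesAbove, ∀ τ ∈ 𝔓.inertia (absoluteGaloisGroup K), ∀ m : Cofree θ (padicCoeffField S), τ • m = m)
    (hvS₀ : v ∉ S₀) (hvP : v ∈ P) (hθN : ∀ g ∈ ramificationSubgroup K P, θ' g = 1) :
    ∃ (lam : padicCoeffIntegers S →+ ℤ_[p]) (hlam : ∀ (c : ℤ_[p]) (y : padicCoeffIntegers S), lam (padicIntToCoeffIntegers S c * y) = c * lam y),
      letI := instX; letI := instQ
      ∀ jv : I.H →ₗ[IwasawaAlgebraO S] DQ.X,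
        (∀ b : I.H, DQ.toDual (jv b) =
          ((layerPairingOf S κ θ' P v (Cofree θ (padicCoeffField S)) hstab (cofreeLamCoeffPairing S lam hlam θ' P v θ hres hstab hθ) htor γB γv hγB hNP hv
            (cofreeLamCoeffPairing_hPred S lam hlam θ' P v θ hres hstab hθ) (cofreeLamCoeffPairing_hPsc S lam hlam θ' P v θ hres hstab hθ)).towerPairing I).pairing hstab b) →
        Function.Exact (jv ∘ₗ (strictCarrier I (strictLevel S κ θ' P S₀) (fun n k f _ hy ↦ smul_mem_strictLevel S κ θ' P S₀ γB n k f hy)).subtype)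
          (gXLinearMapO S D DQ hres hvp instX instQ hιX hιQ hCX hCQ htor hstabK hstab hγ hv hγv) := by
  obtain ⟨lam, hlam, hinj, hsurj⟩ := exists_lam_perfect S
  exact ⟨lam, hlam, fun jv hjv ↦ exact_junctionMap_comp_subtype_cofree_lam_of_lamPerfect S lam hlam θ D DQ hres hvp I hstab hθ htor hγB hNP hv hinst instX instQ
    hιX hιQ hCX hCQ hstabK hγ hγv hP hS₀ hPS₀ hpv hMP hvS₀ hvP hθN hinj hsurj jv hjv⟩

end Cofree

end Summit.BirchSwinnertonDyer.BirchSwinnertonDyer.Theorems.SmallImageRttD2Seq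

end
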